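import Summits.ResolutionOfSingularities.ResolutionOfSingularities.Theses.FoliationDescent
import Summits.ResolutionOfSingularities.ResolutionOfSingularities.Theorems.PAlterationPialtBridgeFoliationDescent
import HarnessLib

/-!
# `LogCanQuotLU` — negative lemmas, part II: "`g ≠ 0`" is LOAD-BEARING (without it the crux is
# RRLU1, hence — with Temkin 2013 — local uniformization over perfect fields); `D ≠ 0` is idle

Support (negative) lemmas for crux `stmt-ResolutionOfSingularities-17082`
(`Summit.ResolutionOfSingularities.ResolutionOfSingularities.Theses.FoliationDescent.LogCanQuotLU`,
route `FoliationDescent`, crux #3 "log-canonical quotients uniformize"), filed by the standing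
disprover (cdisprove cycle 1; work file `Cruxes/LogCanQuotLU/Disproof.lean`; companion of
`Negative/WithoutRegularTop.lean`). This file declares NO definition: the variant statement is
written out inline (section variable `hQ`), and NO declaration concludes the route decl
`LogCanQuotLU` positively.

* `rrLU1_perfect_of_logCanQuotLU_withoutGNeZero` — drop ONLY "`g ≠ 0`": with `g = 0` the
  preservation clause and the MULTIPLICATIVE clause (`(0 • D)^[p] = 1 · (0 • D)`) hold for free,
  so the statement says "the constants of ANY `p`-closed derivation `D ≠ 0` of a field with an
  affine model regular at the centre uniformize"; along the bridge of
  `Theorems/PAlterationPialtBridgeFoliationDescent.lean` with `FolLU` replaced by `S' := B` this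
  gives RRLU1 over perfect fields (local uniformization below every height-one Frobenius sandwich
  `K ⊆ K(y)`, `y^p ∈ K`, of a regular affine variety).
* `isLocallyUniformizable_perfect_of_temkin2013_of_logCanQuotLU_withoutGNeZero` — hence, with
  Temkin's inseparable local uniformization (`Temkin2013`), local uniformization of every finitely
  generated extension of every PERFECT field of characteristic `p` — open from dimension `4` on
  (`Literature.Barriers.ResolutionOfSingularities.DimensionFourFrontier`).
* `logCanQuotLU_body_of_derivation_zero` — by contrast `D ≠ 0` is idle even for the proof: at
  `D = 0` the body holds with `A := S'` (and `D = 0` satisfies the remaining hypotheses through the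
  multiplicative clause), so `D ≠ 0` may be deleted from the crux without loss.

Together with part I: the typed crux is NOT the summit in disguise exactly because of the two
hypotheses "`S'` regular at the centre" and "`g ≠ 0`" (the latter is what makes the log-canonical
disjunction bite); any proof must use both.

## Sources
* M. Temkin, Inseparable local uniformization, J. Algebra 373 (2013), Thm. 1.3.2, Rem. 1.3.5.
  [Temkin2013]
* A. N. Rudakov, I. R. Shafarevich, Inseparable morphisms of algebraic surfaces, Izv. 40 (1976),
  §1. [cite: doi:10.1070/im1976v010n06abeh001833]
-/

noncomputable section

set_option linter.dupNamespace false -- mandated namespace of this single-conjunct summit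

open IsLocalRing
open Literature.AlgebraicGeometry.Resolution
open Summit.ResolutionOfSingularities.ResolutionOfSingularities.Theorems.Pialt.RadiciallyRegular

namespace Summit.ResolutionOfSingularities.ResolutionOfSingularities.Theorems.LogCanQuotLU.Negative

/-! ## Drop "`g ≠ 0`": the crux becomes RRLU1, hence (Temkin) local uniformization -/

section WithoutGNeZero

-- `hQ` : `LogCanQuotLU` with the single hypothesis `g ≠ 0` deleted (all other binders and
-- hypotheses verbatim).
variable (hQ : ∀ p : ℕ, p.Prime → ∀ (k K : Type) [Field k] [CharP k p] [PerfectField k] [Field K]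
    [Algebra k K] (O : ValuationSubring K) (S' : Subalgebra k K) (h' : S'.toSubring ≤ O.toSubring)
    (D : Derivation k K K) (g : K) (R : Subalgebra k K), S'.FG → IsFractionRing S' K →
    IsRegularLocalRing
      (Localization.AtPrime (Ideal.comap (Subring.inclusion h') (IsLocalRing.maximalIdeal O))) →
    D ≠ 0 → (∃ c : K, ∀ x : K, (⇑D)^[p] x = c * D x) →
    (∀ x : K, (∃ a b : K, a ∈ S' ∧ b ∈ S' ∧ b ≠ 0 ∧ b⁻¹ ∈ O ∧ x = a / b) →
      ∃ a b : K, a ∈ S' ∧ b ∈ S' ∧ b ≠ 0 ∧ b⁻¹ ∈ O ∧ (g • D) x = a / b) →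
    ((∃ x : K, (∃ a b : K, a ∈ S' ∧ b ∈ S' ∧ b ≠ 0 ∧ b⁻¹ ∈ O ∧ x = a / b) ∧ (g • D) x ≠ 0 ∧
        ((g • D) x)⁻¹ ∈ O) ∨
      (∃ u : K, (∃ a b : K, a ∈ S' ∧ b ∈ S' ∧ b ≠ 0 ∧ b⁻¹ ∈ O ∧ u = a / b) ∧ u ≠ 0 ∧ u⁻¹ ∈ O ∧
        ∀ x : K, (⇑(g • D))^[p] x = u * (g • D) x)) →
    R.FG → R ≤ S' → (∀ x ∈ R, D x = 0) →
    ∃ (A : Subalgebra k K) (hA : A.toSubring ≤ O.toSubring), R ≤ A ∧ A.FG ∧ (∀ x ∈ A, D x = 0) ∧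
      (∀ x : K, D x = 0 → ∃ a b : K, a ∈ A ∧ b ∈ A ∧ b ≠ 0 ∧ x = a / b) ∧
      IsRegularLocalRing
        (Localization.AtPrime (Ideal.comap (Subring.inclusion hA) (IsLocalRing.maximalIdeal O))))
include hQ

/-- **"`g ≠ 0`" is load-bearing: without it the crux gives RRLU1 over perfect fields with no
foliation input at all.** With `g = 0` the preservation clause and the multiplicative clause
(`u = 1`) hold trivially for ANY `p`-closed `D ≠ 0` on ANY top regular at the centre; feeding the
regular affine `B` of a height-one Frobenius sandwich `K ⊆ L = K(y)`, `y^p ∈ K`, and `D = d/dy`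
yields local uniformization of `O ∩ K` for every valuation ring `O ⊇ B` of `L` (the bridge of
`PAlterationPialtBridgeFoliationDescent.lean` with `FolLU` replaced by `S' := B`).
[cite: Temkin2013, Rem. 1.3.5 (ii)–(iii)] -/
theorem rrLU1_perfect_of_logCanQuotLU_withoutGNeZero (p : ℕ) (hp : p.Prime) :
    ∀ (k K L : Type) [Field k] [CharP k p] [PerfectField k] [Field K] [Field L] [Algebra k K]
      [Algebra K L] [Algebra k L] [IsScalarTower k K L], (⊤ : IntermediateField k K).FG →
      IsPurelyInseparable K L →
      (∃ y : L, y ^ p ∈ (algebraMap K L).range ∧ IntermediateField.adjoin K {y} = ⊤) →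
      ∀ B : Subalgebra k L, B.FG → IsFractionRing B L → IsRegularRing B →
      ∀ O : ValuationSubring L, B.toSubring ≤ O.toSubring →
        IsLocallyUniformizable k K (O.comap (algebraMap K L)) := by
  intro k K L _ _ _ _ _ _ _ _ _ _hfg _hpi hy' B hBfg hBfr hBreg O hBO
  classical
  haveI : Fact p.Prime := ⟨hp⟩
  haveI : CharP K p := charP_of_injective_algebraMap (algebraMap k K).injective p
  haveI := hBfr
  obtain ⟨y, hyp, htop⟩ := hy'
  let f : K →ₐ[k] L := IsScalarTower.toAlgHom k K L
  have hf : (f : K →+* L) = algebraMap K L := rfl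
  rw [← hf]
  by_cases hyK : y ∈ (algebraMap K L).range
  · -- degenerate case `L = K`: the regular `B` itself
    have hsurj : Function.Surjective (algebraMap K L) := by
      intro z
      have hz : z ∈ (⊤ : IntermediateField K L) := IntermediateField.mem_top
      rw [← htop] at hz
      have hle : IntermediateField.adjoin K {y} ≤ ⊥ := by
        rw [IntermediateField.adjoin_le_iff]
        rintro _ rfl
        obtain ⟨c, hc⟩ := hyK
        exact hc ▸ (⊥ : IntermediateField K L).algebraMap_mem c
      obtain ⟨c, hc⟩ := IntermediateField.mem_bot.mp (hle hz)
      exact ⟨c, hc⟩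
    refine isLocallyUniformizable_comap_of_model f O B hBO (fun x _ => hsurj x) hBfg
      (fun z => ?_) (isRegularLocalRing_centre_of_isRegularRing B O hBO)
    obtain ⟨a, b, hb, hab⟩ := IsFractionRing.div_surjective (A := B) (f z)
    exact ⟨a, b, a.2, b.2, fun h => nonZeroDivisors.ne_zero hb (Subtype.ext h), hab.symm⟩
  · -- the height-one step: `D = d/dy`, and `g := 0`
    obtain ⟨D, hDy, hDK, hDp, hDker⟩ := exists_derivation_heightOne k y hyK hyp htop
    have hD0 : D ≠ 0 := by
      intro h
      rw [h] at hDy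
      exact zero_ne_one hDy
    have hDpc : ∃ c : L, ∀ x : L, (⇑D)^[p] x = c * D x := ⟨0, fun x => by rw [hDp, zero_mul]⟩
    have h1S : ∃ a b : L, a ∈ B ∧ b ∈ B ∧ b ≠ 0 ∧ b⁻¹ ∈ O ∧ (1 : L) = a / b :=
      ⟨1, 1, B.one_mem, B.one_mem, one_ne_zero, by rw [inv_one]; exact O.one_mem,
        (div_one (1 : L)).symm⟩
    have hpres : ∀ x : L, (∃ a b : L, a ∈ B ∧ b ∈ B ∧ b ≠ 0 ∧ b⁻¹ ∈ O ∧ x = a / b) →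
        ∃ a b : L, a ∈ B ∧ b ∈ B ∧ b ≠ 0 ∧ b⁻¹ ∈ O ∧ ((0 : L) • D) x = a / b :=
      fun x _ => ⟨0, 1, B.zero_mem, B.one_mem, one_ne_zero, by rw [inv_one]; exact O.one_mem,
        by rw [zero_smul, Derivation.zero_apply, zero_div]⟩
    have hcase : (∃ x : L, (∃ a b : L, a ∈ B ∧ b ∈ B ∧ b ≠ 0 ∧ b⁻¹ ∈ O ∧ x = a / b) ∧
          ((0 : L) • D) x ≠ 0 ∧ (((0 : L) • D) x)⁻¹ ∈ O) ∨
        (∃ u : L, (∃ a b : L, a ∈ B ∧ b ∈ B ∧ b ≠ 0 ∧ b⁻¹ ∈ O ∧ u = a / b) ∧ u ≠ 0 ∧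
          u⁻¹ ∈ O ∧ ∀ x : L, (⇑((0 : L) • D))^[p] x = u * ((0 : L) • D) x) := by
      refine Or.inr ⟨1, h1S, one_ne_zero, by rw [inv_one]; exact O.one_mem, fun x => ?_⟩
      obtain ⟨n, hn⟩ : ∃ n : ℕ, p = n + 1 := ⟨p - 1, (Nat.succ_pred_eq_of_pos hp.pos).symm⟩
      rw [zero_smul, hn, Function.iterate_succ_apply', Derivation.zero_apply, Derivation.zero_apply,
        mul_zero]
    have hRfg : (⊥ : Subalgebra k L).FG := Subalgebra.fg_bot
    have hRconst : ∀ x ∈ (⊥ : Subalgebra k L), D x = 0 := by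
      intro x hx
      obtain ⟨c, rfl⟩ := Algebra.mem_bot.mp hx
      exact D.map_algebraMap c
    obtain ⟨A, hA, -, hAfg, hAconst, hAfrac, hAreg⟩ :=
      hQ p hp k L O B hBO D 0 ⊥ hBfg hBfr (isRegularLocalRing_centre_of_isRegularRing B O hBO)
        hD0 hDpc hpres hcase hRfg bot_le hRconst
    refine isLocallyUniformizable_comap_of_model f O A hA (fun x hx => ?_) hAfg
      (fun z => ?_) hAreg
    · obtain ⟨c, hc⟩ := hDker x (hAconst x hx)
      exact ⟨c, hc⟩
    · obtain ⟨a, b, ha, hb, hb0, hz⟩ := hAfrac (f z) (hDK z)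
      exact ⟨a, b, ha, hb, hb0, hz⟩

/-- **Consequently (with Temkin's inseparable local uniformization) `LogCanQuotLU` without
"`g ≠ 0`" gives local uniformization of every finitely generated extension of every PERFECT
field of characteristic `p`** — the open problem from dimension `4` on
(`Literature.Barriers.ResolutionOfSingularities.DimensionFourFrontier`).
[cite: Temkin2013, Thm. 1.3.2] -/
theorem isLocallyUniformizable_perfect_of_temkin2013_of_logCanQuotLU_withoutGNeZero
    (hT : Temkin2013.{0}) {p : ℕ} [Fact p.Prime] (k : Type) [Field k] [CharP k p]
    [PerfectField k] (K : Type) [Field K] [Algebra k K] (hfg : (⊤ : IntermediateField k K).FG)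
    (O : ValuationSubring K) (hO : ∀ c : k, algebraMap k K c ∈ O) :
    IsLocallyUniformizable k K O :=
  isLocallyUniformizable_of_temkin2013_of_rrLU1_at hT k
    (fun K' L' _ _ _ _ _ _ => rrLU1_perfect_of_logCanQuotLU_withoutGNeZero hQ p Fact.out k K' L')
    K hfg O hO

end WithoutGNeZero

/-! ## By contrast: `D ≠ 0` is idle -/

/-- **`D ≠ 0` is NOT load-bearing**: at the zero derivation the body of `LogCanQuotLU` holds with
`A := S'` (every element is a constant, `Frac S' = K`, and `S'` is regular at the centre by
hypothesis) — whereas `D = 0` does satisfy the remaining hypotheses through the multiplicative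
clause (`0^[p] = u · 0`). So the hypothesis `D ≠ 0` may be deleted from the crux without loss.
[folklore] -/
theorem logCanQuotLU_body_of_derivation_zero (k K : Type) [Field k] [Field K] [Algebra k K]
    (O : ValuationSubring K) (S' : Subalgebra k K) (h' : S'.toSubring ≤ O.toSubring)
    (R : Subalgebra k K) (hS'fg : S'.FG) (hS'fr : IsFractionRing S' K)
    (hreg : IsRegularLocalRing
      (Localization.AtPrime (Ideal.comap (Subring.inclusion h') (IsLocalRing.maximalIdeal O))))
    (hRle : R ≤ S') :
    ∃ (A : Subalgebra k K) (hA : A.toSubring ≤ O.toSubring), R ≤ A ∧ A.FG ∧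
      (∀ x ∈ A, (0 : Derivation k K K) x = 0) ∧
      (∀ x : K, (0 : Derivation k K K) x = 0 → ∃ a b : K, a ∈ A ∧ b ∈ A ∧ b ≠ 0 ∧ x = a / b) ∧
      IsRegularLocalRing
        (Localization.AtPrime (Ideal.comap (Subring.inclusion hA) (IsLocalRing.maximalIdeal O))) := by
  haveI := hS'fr
  refine ⟨S', h', hRle, hS'fg, fun _ _ => Derivation.zero_apply _, fun x _ => ?_, hreg⟩
  obtain ⟨a, b, hb, hab⟩ := IsFractionRing.div_surjective (A := S') x
  exact ⟨a, b, a.2, b.2, fun h => nonZeroDivisors.ne_zero hb (Subtype.ext h), hab.symm⟩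

end Summit.ResolutionOfSingularities.ResolutionOfSingularities.Theorems.LogCanQuotLU.Negative

end
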